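import Literature.IUT.HodgeTheaters.GenuineFKitOfBadLocalClosedPairSlim
import Literature.AnabelianGeometry.SemiGraphs.CosetCategoriesSlimTempered
import HarnessLib

/-!
# [IUTchI] Example 3.2 (iii) `CFromF` at the merge record with tempered (m1): the Div-slimness binder `hds` of the
# [EtTh] Cor. 3.8 (ii) bundle DISCHARGED from the slimness of `𝒟_v̲ = B^temp(X̲̲_v̲)⁰` ([SemiAnbd] Rmk. 3.4.1)

S. Mochizuki, *Inter-universal Teichmüller theory I*, kurims manuscript (May 2020), Example 3.2 (iii) p. 71: «the `p_v`-adic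
Frobenioid constituted by the "base-field-theoretic hull" … `𝒞_v ⊆ ℱ̲_v` … may be reconstructed category-theoretically from `ℱ̲_v`
[cf. Remark 3.2.1 below]» [claim: Mochizuki2012, status: disputed] (D-0012 claim key, series status DISPUTED; PROOF-ONLY composition
BY NAME; nothing of the series is asserted; no side is taken on [IUTchIII] Cor. 3.12).  S. Mochizuki, *Semi-graphs of anabelioids*,
Publ. RIMS **42** (2006), Rmk. 3.4.1 p. 36 («a temperoid is slim as a category if and only if it is temp-slim»)
[cite: MochizukiSemiAnbd2006, Rmk 3.4.1 p.36]; *The geometry of Frobenioids I* (2008), §0 p. 14 (slim categories: every `𝒟_A → 𝒟`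
rigid) [cite: MochizukiFrdI2008, §0 p.14].

STATE BEFORE THIS FILE.  (iii) at the merge record with tempered (m1) is abc-iut-L5-t2's `cFromF_frobeniusBadAt_ofRest` (★ p498213)
modulo abc-iut-L1-t12's [EtTh] Cor. 3.8 (ii) bundle {`hnd` (Φ non-dilating), `hds` (𝒟_v̲ Div-slim w.r.t. Φ: an automorphism of
`𝒟_A → 𝒟_v̲` acting trivially on the divisor monoid is trivial), `hF` ([FrdI] Thm. 5.2 (ii)), `h5` (C38-L05), `hR` ([EtTh] Rmk. 3.6.3)}
on the L2 input `Fr` (CONE-L5-STATUS v2.10: «INPUT-SHAPE»); abc-iut-L5-t2 g10's ★ p507547 derived the (vi)(d) group binder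
`hZ : IsSlimGroup ↥(B x hx).H` at every CLOSED bad pair with slim `Δ_H` and at the stand-in modulo F-0004₁ (`Δ_C` slim).

WHAT THIS FILE PROVES (proof-only; no definition, instance, notation or `sorry`).
* §1 `BadLocalFrobenioid.divSlim_of_isSlim` — **`hds` is NOT a law on the L2 input**: it holds for EVERY divisor monoid as soon as the
  base `𝒟_v̲` is a slim category ([FrdI] §0: all `𝒟_A → 𝒟_v̲` rigid), whatever the action on divisors; and `𝒟_v̲ = CosetCat Π_v̲` IS slim
  for `Π_v̲` tempered and temp-slim (abc-iut-L3's `CosetCat.isSlim_of_isSlimGroup_of_isTempered`, [SemiAnbd] Rmk. 3.4.1):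
  `divSlim_cosetCat_of_isSlimGroup`.
* §2 `InitialThetaData.cFromF_frobeniusBadAt_ofRest_of_isSlimGroup` — (iii) `CFromF` at `frobeniusBadAt B (MergeInputs.ofRest …) x hx`
  modulo {`hnd`, `hF`, `h5`, `hR`} ∪ {`hH` closed, `hZ` : `Π_v̲ = ↥(B x hx).H` slim} (`hds` GONE; `hP` tempered from `hH` by ★ p497246
  `isTempered_badPair_of_isClosed`); `…_of_isClosed_of_ker_slim` — `hZ` ⟸ «`Δ_H` slim» (★ p507547 `isSlimGroup_of_isClosed_badPair`);
  and the joint `ex32_iii_vi_cd_frobeniusBadAt_ofRest_of_isClosed_of_ker_slim` = (iii) ∧ (vi)(c) ∧ (vi)(d) at every CLOSED family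
  modulo {`hnd`, `hF`, `h5`, `hR`} ∪ {`hF′`, `hC`} ∪ {`hH`, `hK`}.
* §3 AT THE STAND-IN FAMILY (`B := badPairAtArrow hA`, (m2) := `m2StandIn`): `cFromF_frobeniusBadAt_ofRest_standIn_of_geom_slim` —
  (iii) modulo {`hnd`, `hF`, `h5`, `hR`} ∪ {F-0004₁ `hΔC : IsSlimGroup D.DeltaC` BY NAME} ONLY (`hH` := ★ p501395
  `isClosed_badPairAtArrow_H`, `hZ` := ★ p507547 `isSlimGroup_badPairAtArrow_H_of_geom_slim`); and ★ p507547's joint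
  `ex32_iii_vi_cd_…_standIn_of_geom_slim` with `hds` REMOVED (`…_of_geom_slim'`).
BINDER CENSUS after this file — Ex3.2(iii) `CFromF` at the merge record with tempered (m1): {`hnd`, `hF`, `h5`, `hR`} on the L2 input
(was {`hnd`, `hds`, `hF`, `h5`, `hR`}) ∪ the group-side {`hH`, `hZ`} | {`hH`, `hK`} | {F-0004₁} exactly as in the (vi)(d) sub-ledger;
FACT unnamed 0; LAW outside the displayed binders 0.  HONEST: the reduction does not touch the FOUNDATIONS-BOUNDARY HOLD on the
genuine (m1) (GAP G-L5-EX32I-1) — the remaining bundle still speaks about the L2 tempered Frobenioid `Fr`, for which the tree has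
no genuine producer; typed ≠ inhabited ≠ proved.
-/

noncomputable section

namespace Literature.IUT.HodgeTheaters

open CategoryTheory Opposite Literature.AlgebraicGeometry.Frobenioids Literature.AlgebraicGeometry.Frobenioids.PadicFrd
  Literature.AnabelianGeometry.SemiGraphs Literature.AnabelianGeometry.EtaleTheta Literature.NumberTheory.NumberFields
  _root_.IsDedekindDomain _root_.NumberField Topology

universe u₀ v₀ u v w

/-! ### §1 Div-slimness from slimness of the base -/

namespace BadLocalFrobenioid

/-- **`hds` from slimness of the base, for ANY monoid** ([FrdI] §0 p. 14: a slim category has all `𝒟_A → 𝒟` rigid, so an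
automorphism of `𝒟_A → 𝒟` is trivial whether or not it fixes divisors). [cite: MochizukiFrdI2008, §0 p.14] -/
theorem divSlim_of_isSlim {Dv : Type u} [Category.{v} Dv] (hD : IsSlim Dv) (Φ : Dvᵒᵖ ⥤ CommMonCat.{w}) :
    ∀ (A : Dv) (α : Aut (Over.forget A)),
      (∀ (B' : Over A) (y : Φ.obj (op B'.left)), Literature.AlgebraicGeometry.Frobenioids.pull Φ (α.hom.app B') y = y) →
        α = 1 :=
  fun A α _ => hD.isRigid_forget A α

/-- **`hds` over the REAL base `𝒟_v = CosetCat Π_v` for `Π_v` tempered and temp-slim** ([SemiAnbd] Rmk. 3.4.1 via abc-iut-L3's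
`CosetCat.isSlim_of_isSlimGroup_of_isTempered`). [cite: MochizukiSemiAnbd2006, Rmk 3.4.1 p.36] -/
theorem divSlim_cosetCat_of_isSlimGroup {P : Type} [Group P] [TopologicalSpace P] [IsTopologicalGroup P]
    (hP : IsTempered P) (hZ : IsSlimGroup P) (Φ : (CosetCat P)ᵒᵖ ⥤ CommMonCat.{w}) :
    ∀ (A : CosetCat P) (α : Aut (Over.forget A)),
      (∀ (B' : Over A) (y : Φ.obj (op B'.left)), Literature.AlgebraicGeometry.Frobenioids.pull Φ (α.hom.app B') y = y) →
        α = 1 :=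
  divSlim_of_isSlim (CosetCat.isSlim_of_isSlimGroup_of_isTempered hP hZ) Φ

end BadLocalFrobenioid

/-! ### §2 (iii) at the merge record with tempered (m1), `hds` discharged -/

variable {F K Fbar : Type} [Field F] [NumberField F] [Field K] [NumberField K] [Algebra F K]
  [Field Fbar] [Algebra F Fbar] [Algebra K Fbar] {E : WeierstrassCurve F}
  [E.IsElliptic] {l : ℕ} {Pb : BadPlacePredicates K} (D : InitialThetaData F K Fbar E l Pb)

namespace InitialThetaData

section ConeClosed

variable (B : ∀ v, v ∈ D.indexCopyBad → D.BadPairAt v)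
  (m2 : ∀ x (hx : x ∈ D.indexCopyBad), BadLocalGroupDatum (D.GalAt x (D.not_mem_arc_of_mem_bad hx)) ↥(B x hx).H)
  (Rr : ∀ x (hx : x ∈ D.indexCopyBad), D.BadTemperedRest B x hx (m2 x hx)) (m4 : RealifiedGlobalSide) (geomTFG : D.geom.extF.GeomTFG)
  (x : D.IndexCopy) (hx : x ∈ D.indexCopyBad)

/-- **[IUTchI] Ex. 3.2 (iii) AT THE MERGE RECORD with tempered (m1), `hds` DISCHARGED**: «`𝒞_v ⊆ ℱ̲_v` may be reconstructed
category-theoretically from `ℱ̲_v`» — `CFromF` — at `frobeniusBadAt B (ofRest …) x hx` for every CLOSED bad pair whose `Π_v̲ = ↥(B x hx).H`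
is slim, modulo {`hnd`, `hF`, `h5`, `hR`} on the L2 input only: ★ p498213 `cFromF_frobeniusBadAt_ofRest` with `hds` := §1 at
`𝒟_v̲ = CosetCat Π_v̲` (tempered by ★ p497246 `isTempered_badPair_of_isClosed`, slim by `hZ`).
([IUTchI] Ex 3.2 (iii) p.71) [claim: Mochizuki2012, status: disputed] -/
theorem cFromF_frobeniusBadAt_ofRest_of_isSlimGroup [Fact (D.primeAt x (D.not_mem_arc_of_mem_bad hx)).Prime]
    (hH : IsClosed ((B x hx).H : Set D.PiC)) (hZ : IsSlimGroup ↥(B x hx).H)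
    (hnd : letI := (Rr x hx).catD₀
      ∀ (A : (m2 x hx).Dvᵒᵖ) (f : A ⟶ A), treeMonoidVocabWeak.{0}.IsNonDilating ((Rr x hx).Fr.Φ.carrier A) ((Rr x hx).Fr.Φ.pull f))
    (hF : letI := (Rr x hx).catD₀; PreFrobenioid.IsFrobenioid (Rr x hx).Fr.toElem)
    (h5 : letI := (Rr x hx).catD₀; (Rr x hx).Fr.BsFldPreStepLimitCriterion (PreFrobenioidData.perfection hF))
    (hR : letI := (Rr x hx).catD₀; (Rr x hx).Fr.Remark363) :
    (D.frobeniusBadAt B (MergeInputs.ofRest D B m2 Rr m4 geomTFG) x hx).CFromF :=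
  letI := (Rr x hx).catD₀
  D.cFromF_frobeniusBadAt_ofRest B m2 Rr m4 geomTFG x hx hnd
    (BadLocalFrobenioid.divSlim_cosetCat_of_isSlimGroup (D.isTempered_badPair_of_isClosed B x hx hH) hZ _) hF h5 hR

/-- **(iii) at the merge record for every CLOSED bad pair with slim `Δ_H`** (`hZ` ⟸ ★ p507547 `isSlimGroup_of_isClosed_badPair` at the
canonical `augOfOver`), modulo {`hnd`, `hF`, `h5`, `hR`} ∪ {`hH`, `hK`}. ([IUTchI] Ex 3.2 (iii) p.71) [claim: Mochizuki2012, status: disputed] -/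
theorem cFromF_frobeniusBadAt_ofRest_of_isClosed_of_ker_slim [Fact (D.primeAt x (D.not_mem_arc_of_mem_bad hx)).Prime]
    (hH : IsClosed ((B x hx).H : Set D.PiC)) (hK : IsSlimGroup (D.m2OfClosed B x hx hH).aug.ker)
    (hnd : letI := (Rr x hx).catD₀
      ∀ (A : (m2 x hx).Dvᵒᵖ) (f : A ⟶ A), treeMonoidVocabWeak.{0}.IsNonDilating ((Rr x hx).Fr.Φ.carrier A) ((Rr x hx).Fr.Φ.pull f))
    (hF : letI := (Rr x hx).catD₀; PreFrobenioid.IsFrobenioid (Rr x hx).Fr.toElem)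
    (h5 : letI := (Rr x hx).catD₀; (Rr x hx).Fr.BsFldPreStepLimitCriterion (PreFrobenioidData.perfection hF))
    (hR : letI := (Rr x hx).catD₀; (Rr x hx).Fr.Remark363) :
    (D.frobeniusBadAt B (MergeInputs.ofRest D B m2 Rr m4 geomTFG) x hx).CFromF :=
  D.cFromF_frobeniusBadAt_ofRest_of_isSlimGroup B m2 Rr m4 geomTFG x hx hH (D.isSlimGroup_of_isClosed_badPair B x hx hH hK)
    hnd hF h5 hR

/-- **[IUTchI] Ex. 3.2 (iii) ∧ (vi)(c) ∧ (vi)(d) JOINTLY at the merge record with tempered (m1), for every CLOSED bad pair with slim `Δ_H`**: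
(vi)(c) UNCONDITIONAL (★ p497246), (iii) modulo {`hnd`, `hF`, `h5`, `hR`} (`hds` discharged), (vi)(d) modulo the [FrdI] Thm. 3.4 (v)
bundles {`hF′`, `hC`} (★ p507547 `dFromF_frobeniusBadAt_ofRest_of_isClosed_of_ker_slim`); group side {`hH`, `hK`}.
([IUTchI] Ex 3.2 (iii)(vi) pp.71-73) [claim: Mochizuki2012, status: disputed] -/
theorem ex32_iii_vi_cd_frobeniusBadAt_ofRest_of_isClosed_of_ker_slim [Fact (D.primeAt x (D.not_mem_arc_of_mem_bad hx)).Prime]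
    (hH : IsClosed ((B x hx).H : Set D.PiC)) (hK : IsSlimGroup (D.m2OfClosed B x hx hH).aug.ker)
    (hnd : letI := (Rr x hx).catD₀
      ∀ (A : (m2 x hx).Dvᵒᵖ) (f : A ⟶ A), treeMonoidVocabWeak.{0}.IsNonDilating ((Rr x hx).Fr.Φ.carrier A) ((Rr x hx).Fr.Φ.pull f))
    (hF : letI := (Rr x hx).catD₀; PreFrobenioid.IsFrobenioid (Rr x hx).Fr.toElem)
    (h5 : letI := (Rr x hx).catD₀; (Rr x hx).Fr.BsFldPreStepLimitCriterion (PreFrobenioidData.perfection hF))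
    (hR : letI := (Rr x hx).catD₀; (Rr x hx).Fr.Remark363)
    (hF' : letI := (Rr x hx).catD₀
      ∀ e : (Rr x hx).Fr.category ≌ (Rr x hx).Fr.category, FrdI.Thm34Sub.StdHyp (Rr x hx).Fr.toElem (Rr x hx).Fr.toElem e)
    (hC : letI := (Rr x hx).catD₀
      ∀ e : (Rr x hx).Fr.hullCategory ≌ (Rr x hx).Fr.hullCategory,
      FrdI.Thm34Sub.StdHyp (ModelFrobenioid.toElem (Rr x hx).Fr.bsFldMonoid (Rr x hx).Fr.cnstFnBsFunctor (Rr x hx).Fr.divFNatTrans)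
        (ModelFrobenioid.toElem (Rr x hx).Fr.bsFldMonoid (Rr x hx).Fr.cnstFnBsFunctor (Rr x hx).Fr.divFNatTrans) e) :
    (D.frobeniusBadAt B (MergeInputs.ofRest D B m2 Rr m4 geomTFG) x hx).CFromF ∧
      (D.frobeniusBadAt B (MergeInputs.ofRest D B m2 Rr m4 geomTFG) x hx).BasesFromC ∧
      (D.frobeniusBadAt B (MergeInputs.ofRest D B m2 Rr m4 geomTFG) x hx).DFromF :=
  ⟨D.cFromF_frobeniusBadAt_ofRest_of_isClosed_of_ker_slim B m2 Rr m4 geomTFG x hx hH hK hnd hF h5 hR,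
    D.basesFromC_frobeniusBadAt B _ x hx,
    D.dFromF_frobeniusBadAt_ofRest_of_isClosed_of_ker_slim B m2 Rr m4 geomTFG x hx hH hF' hC hK⟩

end ConeClosed

/-! ### §3 At the stand-in family: (iii) modulo {`hnd`, `hF`, `h5`, `hR`} ∪ {F-0004₁} only -/

section ConeStandIn

variable (hA : D.geom.pe.ArrowCoveringClaims) (CG : D.geom.pe.CuspGalois) (x : D.IndexCopy) (hx : x ∈ D.indexCopyBad)

/-- **[IUTchI] Ex. 3.2 (iii) AT THE STAND-IN FAMILY with tempered (m1) INPUT `Rr`, `hds`/`hH`/`hP`/`hZ` ALL DISCHARGED — modulo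
{`hnd`, `hF`, `h5`, `hR`} on the L2 input and F-0004₁ (`Δ_C` slim) BY NAME**: at `frobeniusBadAt (badPairAtArrow hA) (MergeInputs.ofRest …
(m2StandIn …) Rr m4 hTFG) x hx`, with `hH` := ★ p501395 `isClosed_badPairAtArrow_H` and `hZ` := ★ p507547 `isSlimGroup_badPairAtArrow_H_of_geom_slim`.
([IUTchI] Ex 3.2 (iii) p.71) [claim: Mochizuki2012, status: disputed] -/
theorem cFromF_frobeniusBadAt_ofRest_standIn_of_geom_slim (hTFG : D.geom.extF.GeomTFG)
    (Rr : ∀ v (hv : v ∈ D.indexCopyBad),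
      haveI : Fact (D.primeAt v (D.not_mem_arc_of_mem_bad hv)).Prime := D.fact_primeAt_prime v _
      D.BadTemperedRest (fun u _ => D.badPairAtArrow hA u) v hv (D.m2StandIn hA CG hTFG v (D.not_mem_arc_of_mem_bad hv)))
    (m4 : RealifiedGlobalSide) [Fact (D.primeAt x (D.not_mem_arc_of_mem_bad hx)).Prime]
    (hnd : letI := (Rr x hx).catD₀
      ∀ (A : (D.m2StandIn hA CG hTFG x (D.not_mem_arc_of_mem_bad hx)).Dvᵒᵖ) (f : A ⟶ A),
        treeMonoidVocabWeak.{0}.IsNonDilating ((Rr x hx).Fr.Φ.carrier A) ((Rr x hx).Fr.Φ.pull f))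
    (hF : letI := (Rr x hx).catD₀; PreFrobenioid.IsFrobenioid (Rr x hx).Fr.toElem)
    (h5 : letI := (Rr x hx).catD₀; (Rr x hx).Fr.BsFldPreStepLimitCriterion (PreFrobenioidData.perfection hF))
    (hR : letI := (Rr x hx).catD₀; (Rr x hx).Fr.Remark363)
    (hΔC : IsSlimGroup D.DeltaC) :
    (D.frobeniusBadAt _ (MergeInputs.ofRest D _
      (fun v hv => haveI : Fact (D.primeAt v (D.not_mem_arc_of_mem_bad hv)).Prime := D.fact_primeAt_prime v _
        D.m2StandIn hA CG hTFG v (D.not_mem_arc_of_mem_bad hv)) Rr m4 hTFG) x hx).CFromF :=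
  D.cFromF_frobeniusBadAt_ofRest_of_isSlimGroup _ _ Rr m4 hTFG x hx (D.isClosed_badPairAtArrow_H hA CG hTFG x hx)
    (D.isSlimGroup_badPairAtArrow_H_of_geom_slim hA CG x (D.not_mem_arc_of_mem_bad hx) hTFG hΔC) hnd hF h5 hR

/-- **★ p507547's joint (iii) ∧ (vi)(c) ∧ (vi)(d) at the stand-in family with `hds` REMOVED**: binders {`hnd`, `hF`, `h5`, `hR`} ∪ {`hF′`, `hC`}
∪ {F-0004₁} and nothing else. ([IUTchI] Ex 3.2 (iii)(vi) pp.71-73) [claim: Mochizuki2012, status: disputed] -/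
theorem ex32_iii_vi_cd_frobeniusBadAt_ofRest_standIn_of_geom_slim' (hTFG : D.geom.extF.GeomTFG)
    (Rr : ∀ v (hv : v ∈ D.indexCopyBad),
      haveI : Fact (D.primeAt v (D.not_mem_arc_of_mem_bad hv)).Prime := D.fact_primeAt_prime v _
      D.BadTemperedRest (fun u _ => D.badPairAtArrow hA u) v hv (D.m2StandIn hA CG hTFG v (D.not_mem_arc_of_mem_bad hv)))
    (m4 : RealifiedGlobalSide) [Fact (D.primeAt x (D.not_mem_arc_of_mem_bad hx)).Prime]
    (hnd : letI := (Rr x hx).catD₀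
      ∀ (A : (D.m2StandIn hA CG hTFG x (D.not_mem_arc_of_mem_bad hx)).Dvᵒᵖ) (f : A ⟶ A),
        treeMonoidVocabWeak.{0}.IsNonDilating ((Rr x hx).Fr.Φ.carrier A) ((Rr x hx).Fr.Φ.pull f))
    (hF : letI := (Rr x hx).catD₀; PreFrobenioid.IsFrobenioid (Rr x hx).Fr.toElem)
    (h5 : letI := (Rr x hx).catD₀; (Rr x hx).Fr.BsFldPreStepLimitCriterion (PreFrobenioidData.perfection hF))
    (hR : letI := (Rr x hx).catD₀; (Rr x hx).Fr.Remark363)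
    (hF' : letI := (Rr x hx).catD₀
      ∀ e : (Rr x hx).Fr.category ≌ (Rr x hx).Fr.category, FrdI.Thm34Sub.StdHyp (Rr x hx).Fr.toElem (Rr x hx).Fr.toElem e)
    (hC : letI := (Rr x hx).catD₀
      ∀ e : (Rr x hx).Fr.hullCategory ≌ (Rr x hx).Fr.hullCategory,
      FrdI.Thm34Sub.StdHyp (ModelFrobenioid.toElem (Rr x hx).Fr.bsFldMonoid (Rr x hx).Fr.cnstFnBsFunctor (Rr x hx).Fr.divFNatTrans)
        (ModelFrobenioid.toElem (Rr x hx).Fr.bsFldMonoid (Rr x hx).Fr.cnstFnBsFunctor (Rr x hx).Fr.divFNatTrans) e)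
    (hΔC : IsSlimGroup D.DeltaC) :
    (D.frobeniusBadAt _ (MergeInputs.ofRest D _
      (fun v hv => haveI : Fact (D.primeAt v (D.not_mem_arc_of_mem_bad hv)).Prime := D.fact_primeAt_prime v _
        D.m2StandIn hA CG hTFG v (D.not_mem_arc_of_mem_bad hv)) Rr m4 hTFG) x hx).CFromF ∧
    (D.frobeniusBadAt _ (MergeInputs.ofRest D _
      (fun v hv => haveI : Fact (D.primeAt v (D.not_mem_arc_of_mem_bad hv)).Prime := D.fact_primeAt_prime v _
        D.m2StandIn hA CG hTFG v (D.not_mem_arc_of_mem_bad hv)) Rr m4 hTFG) x hx).BasesFromC ∧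
    (D.frobeniusBadAt _ (MergeInputs.ofRest D _
      (fun v hv => haveI : Fact (D.primeAt v (D.not_mem_arc_of_mem_bad hv)).Prime := D.fact_primeAt_prime v _
        D.m2StandIn hA CG hTFG v (D.not_mem_arc_of_mem_bad hv)) Rr m4 hTFG) x hx).DFromF :=
  ⟨D.cFromF_frobeniusBadAt_ofRest_standIn_of_geom_slim hA CG x hx hTFG Rr m4 hnd hF h5 hR hΔC,
    D.basesFromC_frobeniusBadAt _ _ x hx,
    D.dFromF_frobeniusBadAt_ofRest_standIn_of_geom_slim hA CG x hx hTFG Rr m4 hF' hC hΔC⟩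

end ConeStandIn

end InitialThetaData

end Literature.IUT.HodgeTheaters

end
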